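import Literature.MathematicalPhysics.QuantumFieldTheory.Balaban1983to89.B9LeafXClassAntitone

/-!
# [Balaban1985BackgroundPropagators] The printed statements of Theorems 3.9 ∕ 3.11 ∕ 3.12 ∕ 3.13 and of (3.49) ∕ (3.132) ∕ the kernel-sum row are ANTITONE IN THE CLASS
# (3.35)–(3.36) ALONG A SUB-FAMILY `f : J → MemberY …` — the along-`f` companions of ✓`B9LeafXClassAntitone.*_antitone` ∕ `rwKernelSumYields_R`

Cell `pub-ymgap` (HUMAN RULING D-0062), node N06; IR-N06-SECTION-2 road **R1** («J-twin of the producer cone», ★★★ director-ym №524 (3): STAGED, sibling files only),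
dag-n06-d's `R1-JTWIN-SPEC.md` rule (R)′.  Seat `pub-ymgap-dag-n06-d` g30.  Consumer: «KCXS»ᴶ (the N06 knit pair along `f`), which receives the section-tainted rows
15∕16∕17∕20∕21∕25∕26 ALONG `f` at the regular classes `(R₁, R₂)` and must hand them to the apex ✓`B9LeafXCodedKnitUParHXJ.b9LeafX_carriersYUParHX_ofReindexed` at
the carrier classes `(regC335, regC336)` — for the full member family the parent's `*_antitone` do this; along `f` these seven two-line companions do.

WHAT.  For each parent lemma `X_antitone (h1 : ClassIncl R₁ c R₁' c') [(h2 : …)] (letters …) (h : <Printed statement> c' geo9Y (bg9YR 𝔸 G R₁' R₂') (fun x => …)) :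
<same> c geo9Y (bg9YR 𝔸 G R₁ R₂) (fun x => …)`, the companion `X_antitone_comp (f : J → MemberY …)` has the three family arguments along `f`
(`(fun j => geo9Y (f j)) (fun j => bg9YR 𝔸 G R (f j)) (fun j => … (f j) …)`), the letter families and the class inclusions `h1 h2` MEMBER-WIDE (read at `f j`).
PROOF: the parent's destructure-and-reassemble two-liners with `x ↦ j`, `h1 x ↦ h1 (f j)`; `rwKernelSumYields_R_comp` is definitional (`:= h`) like its parent.
HONEST FRAMING.  Bookkeeping (monotonicity of hypothesis-shaped statements in a displayed class inclusion); nothing of [B9] asserted; COUNT-NEUTRAL (`--supports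
stmt-QuantumFields-27239`); N06 NOT discharged; nothing continuum ∕ OS ∕ mass gap ∕ Clay.  0 `def`, 0 `sorry`.  NEW file; the parent untouched.
[cite: Balaban1985BackgroundPropagators, (3.35)–(3.36) p.396, Thm 3.9 p.413, Thm 3.11 p.416, Thm 3.12 (3.133) pp.422–423, Thm 3.13 p.426, (3.49) p.399, (3.132) p.422]
-/

noncomputable section

namespace Literature.MathematicalPhysics.QuantumFieldTheory.Balaban1983to89.B9LeafXClassAntitoneJ

open B6GlobalChartV1 (PV)
open B9BackgroundsKLevelV1 (CfgV1)
open B9PinMembersKLevelV1 (MemberY geo9Y bg9Y)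
open B9BackgroundsKLevelV1R (RegFamY bg9YR regY335 regY336 regYP335 regYP336 kernelFamilyR kernelFamilyRY siteKernelR fineKernelR rwExpansionR rwKernelExpansionR hKernelR hKernelRY)
open B9PinGeometryKLevelV1 (dOmegaY OmKY inΛY unitDistY InCubeY c35Y c35Y_pos)
open B9PinCarriersKLevelV1 (OperatorLayerY carriersY)
open B9PinCarriersKLevelV1P (carriersYP)
open B9PinCarriersKLevelV1R (carriersYR)
open B9PinGeometryKLevelV1B (c35B c35B_pos ten_L3_le_c35B ten_L4_le_c35B c35Y_le_ten)

variable {d ℓ : ℕ} {hd : 1 ≤ d + 1} {hL : Odd (ℓ + 1) ∧ 1 < ℓ + 1} {b₀ b₁ : ℝ} {Mstar : ℕ}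
variable {𝔸 : Type} [NormedRing 𝔸] [NormedAlgebra ℂ 𝔸] [CompleteSpace 𝔸] {G : Subgroup 𝔸ˣ}

open B9LeafXClassAntitone (ClassIncl)

variable {R₁ R₂ R₁' R₂' : RegFamY d ℓ hd hL b₀ b₁ Mstar 𝔸} {c c' : ℝ} {dd : ℕ} {J : Type} (f : J → MemberY d ℓ hd hL b₀ b₁ Mstar)

/-- the kernel-summation leaf for (3.98) is class-free. [cite: Balaban1985BackgroundPropagators, Thm 3.9 p.413 (bookkeeping)] -/
theorem rwKernelSumYields_R_comp (E9 : ∀ x : MemberY d ℓ hd hL b₀ b₁ Mstar, B9.RWKernelExpansion (geo9Y x) (bg9Y 𝔸 G x))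
    (Cinv : ∀ x : MemberY d ℓ hd hL b₀ b₁ Mstar, B9.SiteKernel (geo9Y x) (bg9Y 𝔸 G x))
    (h : B9.RWKernelSumYields dd (fun j : J => geo9Y (f j)) (fun j : J => bg9YR 𝔸 G R₁' R₂' (f j)) (fun j => rwKernelExpansionR R₁' R₂' (E9 (f j))) (fun j => siteKernelR R₁' R₂' (Cinv (f j)))) :
    B9.RWKernelSumYields dd (fun j : J => geo9Y (f j)) (fun j : J => bg9YR 𝔸 G R₁ R₂ (f j)) (fun j => rwKernelExpansionR R₁ R₂ (E9 (f j))) (fun j => siteKernelR R₁ R₂ (Cinv (f j))) := h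

/-- Theorem 3.9 as typed is antitone in the class (3.35). [cite: Balaban1985BackgroundPropagators, Thm 3.9 (3.98)–(3.99) p.413] -/
theorem thm39Printed_antitone_comp (h1 : ClassIncl R₁ c R₁' c') (E : ∀ x : MemberY d ℓ hd hL b₀ b₁ Mstar, B9.RWKernelExpansion (geo9Y x) (bg9Y 𝔸 G x))
    (h : B9.Thm39Printed dd c' (fun j : J => geo9Y (f j)) (fun j : J => bg9YR 𝔸 G R₁' R₂' (f j)) (fun j => rwKernelExpansionR R₁' R₂' (E (f j)))) :
    B9.Thm39Printed dd c (fun j : J => geo9Y (f j)) (fun j : J => bg9YR 𝔸 G R₁ R₂ (f j)) (fun j => rwKernelExpansionR R₁ R₂ (E (f j))) := by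
  obtain ⟨M₂, a₀, δ₀, C, c', hM₂, ha₀, hδ₀, hC, hc', H⟩ := h
  exact ⟨M₂, a₀, δ₀, C, c', hM₂, ha₀, hδ₀, hC, hc', fun j hM α₀ hα hMa U hU => H j hM α₀ hα hMa U (h1 (f j) α₀ U hα hU)⟩

/-- Theorem 3.11 as typed is antitone in the class (3.35). [cite: Balaban1985BackgroundPropagators, Thm 3.11 p.416] -/
theorem thm311Printed_antitone_comp (h1 : ClassIncl R₁ c R₁' c') (PosDef : ∀ x : MemberY d ℓ hd hL b₀ b₁ Mstar, Fin 5 → (bg9Y 𝔸 G x).Cfg → Prop)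
    (h : B9.Thm311Printed c' (fun j : J => geo9Y (f j)) (fun j : J => bg9YR 𝔸 G R₁' R₂' (f j)) (fun j => PosDef (f j))) :
    B9.Thm311Printed c (fun j : J => geo9Y (f j)) (fun j : J => bg9YR 𝔸 G R₁ R₂ (f j)) (fun j => PosDef (f j)) := by
  obtain ⟨M₃, a₀, hM₃, ha₀, H⟩ := h
  exact ⟨M₃, a₀, hM₃, ha₀, fun j hM α₀ hα hMa U hU => H j hM α₀ hα hMa U (h1 (f j) α₀ U hα hU)⟩

/-- the claim (3.49) as typed is antitone in the class (3.35). [cite: Balaban1985BackgroundPropagators, (3.49) p.399] -/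
theorem stmt349Printed_antitone_comp (h1 : ClassIncl R₁ c R₁' c') (P : ∀ x : MemberY d ℓ hd hL b₀ b₁ Mstar, B9.FineKernel (geo9Y x) (bg9Y 𝔸 G x))
    (h : B9.Stmt349Printed dd c' (fun j : J => geo9Y (f j)) (fun j : J => bg9YR 𝔸 G R₁' R₂' (f j)) (fun j => fineKernelR R₁' R₂' (P (f j)))) :
    B9.Stmt349Printed dd c (fun j : J => geo9Y (f j)) (fun j : J => bg9YR 𝔸 G R₁ R₂ (f j)) (fun j => fineKernelR R₁ R₂ (P (f j))) := by
  obtain ⟨M₁, δ₀, a₀, C, hM₁, hδ₀, ha₀, hC, H⟩ := h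
  exact ⟨M₁, δ₀, a₀, C, hM₁, hδ₀, ha₀, hC, fun j hM α₀ hα hMa U hU => H j hM α₀ hα hMa U (h1 (f j) α₀ U hα hU)⟩

/-- Theorem 3.12 as typed (random-walk ∕ positivity read through the re-typings) is antitone in the classes (3.35)–(3.36).
[cite: Balaban1985BackgroundPropagators, Thm 3.12 (3.133) pp.422–423] -/
theorem thm312Printed_antitone_comp (h1 : ClassIncl R₁ c R₁' c') (h2 : ClassIncl R₂ c R₂' c')
    (GD G₁ : ∀ x : MemberY d ℓ hd hL b₀ b₁ Mstar, B9.KernelFamily (geo9Y x) (bg9Y 𝔸 G x))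
    (H H₁ : ∀ x : MemberY d ℓ hd hL b₀ b₁ Mstar, B9.HKernel (geo9Y x) (bg9Y 𝔸 G x))
    (HR : ∀ x : MemberY d ℓ hd hL b₀ b₁ Mstar, B9.KernelFamily (geo9Y x) (bg9Y 𝔸 G x) → (bg9Y 𝔸 G x).Cfg → ℝ → Prop)
    (HRH : ∀ x : MemberY d ℓ hd hL b₀ b₁ Mstar, B9.HKernel (geo9Y x) (bg9Y 𝔸 G x) → (bg9Y 𝔸 G x).Cfg → ℝ → Prop)
    (PK : ∀ x : MemberY d ℓ hd hL b₀ b₁ Mstar, B9.KernelFamily (geo9Y x) (bg9Y 𝔸 G x) → (bg9Y 𝔸 G x).Cfg → Prop)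
    (h : B9.Thm312Printed dd c' (fun j : J => geo9Y (f j)) (fun j : J => bg9YR 𝔸 G R₁' R₂' (f j)) (fun j => kernelFamilyR R₁' R₂' (GD (f j))) (fun j => kernelFamilyR R₁' R₂' (G₁ (f j)))
      (fun j => hKernelR R₁' R₂' (H (f j))) (fun j => hKernelR R₁' R₂' (H₁ (f j))) (fun j K => HR (f j) (kernelFamilyRY K)) (fun j K => HRH (f j) (hKernelRY K))
      (fun j K => PK (f j) (kernelFamilyRY K))) :
    B9.Thm312Printed dd c (fun j : J => geo9Y (f j)) (fun j : J => bg9YR 𝔸 G R₁ R₂ (f j)) (fun j => kernelFamilyR R₁ R₂ (GD (f j))) (fun j => kernelFamilyR R₁ R₂ (G₁ (f j)))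
      (fun j => hKernelR R₁ R₂ (H (f j))) (fun j => hKernelR R₁ R₂ (H₁ (f j))) (fun j K => HR (f j) (kernelFamilyRY K)) (fun j K => HRH (f j) (hKernelRY K))
      (fun j K => PK (f j) (kernelFamilyRY K)) := by
  obtain ⟨M₄, δ₀, a₀, B₀, Bβ, Bε, Bεβ, hM₄, hδ₀, ha₀, hB₀, HH⟩ := h
  refine ⟨M₄, δ₀, a₀, B₀, Bβ, Bε, Bεβ, hM₄, hδ₀, ha₀, hB₀, fun j hM α₀ hα hMa U hU hU' => ?_⟩
  obtain ⟨HK, HHk⟩ := HH j hM α₀ hα hMa U (h1 (f j) α₀ U hα hU) (h2 (f j) α₀ U hα hU')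
  rw [List.forall_mem_cons, List.forall_mem_singleton] at HK HHk
  refine ⟨?_, ?_⟩
  · rw [List.forall_mem_cons, List.forall_mem_singleton]
    exact ⟨HK.1, HK.2⟩
  · rw [List.forall_mem_cons, List.forall_mem_singleton]
    exact ⟨HHk.1, HHk.2⟩

/-- Theorem 3.13 as typed is antitone in the classes (3.35)–(3.36). [cite: Balaban1985BackgroundPropagators, Thm 3.13 p.426] -/
theorem thm313Printed_antitone_comp (h1 : ClassIncl R₁ c R₁' c') (h2 : ClassIncl R₂ c R₂' c')
    (GG : ∀ x : MemberY d ℓ hd hL b₀ b₁ Mstar, B9.KernelFamily (geo9Y x) (bg9Y 𝔸 G x))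
    (HR : ∀ x : MemberY d ℓ hd hL b₀ b₁ Mstar, B9.KernelFamily (geo9Y x) (bg9Y 𝔸 G x) → (bg9Y 𝔸 G x).Cfg → ℝ → Prop)
    (PK : ∀ x : MemberY d ℓ hd hL b₀ b₁ Mstar, B9.KernelFamily (geo9Y x) (bg9Y 𝔸 G x) → (bg9Y 𝔸 G x).Cfg → Prop)
    (h : B9.Thm313Printed c' (fun j : J => geo9Y (f j)) (fun j : J => bg9YR 𝔸 G R₁' R₂' (f j)) (fun j => kernelFamilyR R₁' R₂' (GG (f j))) (fun j K => HR (f j) (kernelFamilyRY K))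
      (fun j K => PK (f j) (kernelFamilyRY K))) :
    B9.Thm313Printed c (fun j : J => geo9Y (f j)) (fun j : J => bg9YR 𝔸 G R₁ R₂ (f j)) (fun j => kernelFamilyR R₁ R₂ (GG (f j))) (fun j K => HR (f j) (kernelFamilyRY K))
      (fun j K => PK (f j) (kernelFamilyRY K)) := by
  obtain ⟨M₄, δ₀, a₀, B₀, Bβ, Bε, Bεβ, hM₄, hδ₀, ha₀, hB₀, HH⟩ := h
  exact ⟨M₄, δ₀, a₀, B₀, Bβ, Bε, Bεβ, hM₄, hδ₀, ha₀, hB₀,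
    fun j hM α₀ hα hMa U hU hU' => HH j hM α₀ hα hMa U (h1 (f j) α₀ U hα hU) (h2 (f j) α₀ U hα hU')⟩

/-- the claim (3.132) as typed is antitone in the classes (3.35)–(3.36). [cite: Balaban1985BackgroundPropagators, (3.132) p.422] -/
theorem stmt3132Printed_antitone_comp (h1 : ClassIncl R₁ c R₁' c') (h2 : ClassIncl R₂ c R₂' c')
    (Q Q₁ : ∀ x : MemberY d ℓ hd hL b₀ b₁ Mstar, B9.SiteKernel (geo9Y x) (bg9Y 𝔸 G x))
    (h : B9.Stmt3132Printed dd c' (fun j : J => geo9Y (f j)) (fun j : J => bg9YR 𝔸 G R₁' R₂' (f j)) (fun j => siteKernelR R₁' R₂' (Q (f j))) (fun j => siteKernelR R₁' R₂' (Q₁ (f j)))) :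
    B9.Stmt3132Printed dd c (fun j : J => geo9Y (f j)) (fun j : J => bg9YR 𝔸 G R₁ R₂ (f j)) (fun j => siteKernelR R₁ R₂ (Q (f j))) (fun j => siteKernelR R₁ R₂ (Q₁ (f j))) := by
  obtain ⟨M₄, δ₁, a₀, C, hM₄, hδ₁, ha₀, hC, HH⟩ := h
  exact ⟨M₄, δ₁, a₀, C, hM₄, hδ₁, ha₀, hC, fun j hM α₀ hα hMa U hU hU' => HH j hM α₀ hα hMa U (h1 (f j) α₀ U hα hU) (h2 (f j) α₀ U hα hU')⟩

end Literature.MathematicalPhysics.QuantumFieldTheory.Balaban1983to89.B9LeafXClassAntitoneJ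

end
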